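import Literature.Geometry.Lorentzian.WeightedNormsScaling
import Literature.Geometry.Lorentzian.WeightedNormsProofs
import Mathlib.Analysis.InnerProductSpace.Calculus
import HarnessLib

/-!
# Unit-annulus bookkeeping for Mao–Oh–Tao's scaled Sobolev sizes, and the isotropic mass slot

Companion of `WeightedNormsScaling` (the dilation law).  Mao–Oh–Tao arXiv:2308.13031, Def. 1.5,
measure asymptotic flatness by the unit-scale Sobolev norm of the dilate `u(R·)` on the annulus
`Ã₁ = {1/2 < |x| < 4}` (footnote: `‖u‖_{Ḣ^s(Ã_R)} := R^{−s+3/2}‖u(R·)‖_{H^s(Ã₁)}`).  This file supplies the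
generic, fully proved toolkit for converting the tree's `(1+r)`-weighted seminorms (`WeightedNorms`,
Bartnik 1986 (1.2)–(1.3)) and pointwise decay classes into such unit-annulus sizes:

* `weightedSobolevSeminorm_congr_open`, `weightedSobolevSeminorm_le_add_of_eq`,
  `weightedSobolevSeminorm_le_add₃_of_eq` — congruence on open sets and Minkowski for two / three smooth
  summands in the pointwise-equation form (from the tree's `weightedSobolevSeminorm_add_le_holds`);
  `setOf_lt_norm_mem_cobounded`;
* §U0 `measurableSet_annulus`, `isOpen_annulus`, `annulus_subset_ball`, `one_add_norm_rpow_le` (the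
  inhomogeneous weight is harmless on `Ã₁ ⊆ B₄`), `exists_radius_of_isLittleO` (finitely many little-o
  decay statements ⇒ one radius), `ballFactor`, `weightedSobolevSeminorm_le_of_pointwise` (sup → `Hˢ(Ã₁)`);
* §U1 `weight_h_le`, `weight_k_le` — the pointwise `R`-power side conditions of
  `scaledAnnulusSize_le_adaptedLO` DISCHARGED with `c_h = c_k = 3·10¹²/R` (`R ≥ 1`, `γ ≥ 0`);
* §U2 the isotropic mass slot `isoSlot ΔM x = (2ΔM/|x|)·δ` (the `2M/r` term of Christodoulou–Klainerman's
  strongly asymptotically flat class, CK 1993 (1.0.9a)): smooth off the origin, additive in `ΔM`,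
  `(−1)`-homogeneous (`isoSlot_smul`), of finite `Hˢ(Ã₁)` size (`weightedSobolevSeminorm_isoSlot_lt_top`);
* §U3 `scaled_seminorm_le_of_decay` — pointwise decay `‖Dᵐ F(x)‖ ≤ |x|^{−(1+j+m)}` beyond `r` gives
  `‖Rʲ F(R·)‖_{Hˢ(Ã₁)} ≤ C/R` for `R ≥ 2r`.

Provenance: decomp-fsc lens-2 g36 side file `ScaledAF36.lean`, §§ SobolevToolkit, U0–U3 and the
`isoSlot` block of its kernel texts (farm-checked there), re-homed verbatim (docstrings completed, cites
added; `(E3 →L[ℝ] E3 →L[ℝ] ℝ)` spelled out).  NOT here: the route-side consequence (b0) «finite weighted graft size ⇒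
scaled-AF» and the LO-regularity / graft-size vocabulary it is stated in.
-/

noncomputable section

namespace Literature.Geometry.Lorentzian

open scoped ContDiff Topology ENNReal Pointwise
open Filter Set Function _root_.MeasureTheory Metric

section SobolevToolkit

variable {G : Type*} [NormedAddCommGroup G] [NormedSpace ℝ G]

/-- Congruence of the weighted seminorm on an OPEN set: fields that agree on `U` have the same `H^s_δ(U)` size (each `Dᵐ` is local). [cite: Bartnik1986, (1.3)] -/
theorem weightedSobolevSeminorm_congr_open {U : Set E3} (hU : IsOpen U) (s : ℕ) (δ : ℝ) {f g : E3 → G}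
    (h : ∀ x ∈ U, f x = g x) : weightedSobolevSeminorm U s δ f = weightedSobolevSeminorm U s δ g := by
  unfold weightedSobolevSeminorm
  congr 1
  refine Finset.sum_congr rfl fun m _ ↦ setLIntegral_congr_fun hU.measurableSet fun x hx ↦ ?_
  have hev : f =ᶠ[𝓝 x] g := Filter.eventuallyEq_of_mem (hU.mem_nhds hx) h
  rw [(hev.iteratedFDeriv ℝ m).eq_of_nhds]

/-- Minkowski for two smooth summands on an open set, in the pointwise-equation form `u = f + g` on `U` (from the tree's `weightedSobolevSeminorm_add_le_holds`). [cite: Bartnik1986, (1.3)] -/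
theorem weightedSobolevSeminorm_le_add_of_eq {U : Set E3} (hU : IsOpen U) (s : ℕ) (δ : ℝ) {u f g : E3 → G}
    (hf : ContDiffOn ℝ ∞ f U) (hg : ContDiffOn ℝ ∞ g U) (h : ∀ x ∈ U, u x = f x + g x) :
    weightedSobolevSeminorm U s δ u ≤ weightedSobolevSeminorm U s δ f + weightedSobolevSeminorm U s δ g := by
  rw [weightedSobolevSeminorm_congr_open hU s δ (g := f + g) h]
  exact weightedSobolevSeminorm_add_le_holds hU s δ hf hg

/-- The exterior region `{R < |x|} = B_R^c` of Mao–Oh–Tao, Def. 1.5 is a neighbourhood of infinity (`cobounded`). [cite: MaoOhTao2023, Def. 1.5 (arXiv p. 6)] -/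
theorem setOf_lt_norm_mem_cobounded (R : ℝ) : {x : E3 | R < ‖x‖} ∈ Bornology.cobounded E3 := by
  have h : (closedBall (0 : E3) R)ᶜ ∈ Bornology.cobounded E3 :=
    (Metric.hasBasis_cobounded_compl_closedBall (0 : E3)).mem_of_mem trivial
  refine Filter.mem_of_superset h fun x hx ↦ ?_
  rw [mem_compl_iff, mem_closedBall_zero_iff, not_le] at hx
  exact hx

/-! #### §U0  annulus bookkeeping, radius extraction, sup-to-`Hˢ(Ã₁)` conversion -/

/-- The unit annulus `Ã₁ = {1/2 < |x| < 4}` of Mao–Oh–Tao, Def. 1.5 is measurable. [cite: MaoOhTao2023, Def. 1.5 (footnote, arXiv p. 6)] -/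
theorem measurableSet_annulus : MeasurableSet {x : E3 | 1 / 2 < ‖x‖ ∧ ‖x‖ < 4} :=
  measurableSet_Ioo.preimage continuous_norm.measurable

/-- The unit annulus `Ã₁ = {1/2 < |x| < 4}` is open. [cite: MaoOhTao2023, Def. 1.5 (footnote, arXiv p. 6)] -/
theorem isOpen_annulus : IsOpen {x : E3 | 1 / 2 < ‖x‖ ∧ ‖x‖ < 4} :=
  isOpen_Ioo.preimage continuous_norm

/-- `Ã₁ ⊆ B₄`. [cite: MaoOhTao2023, Def. 1.5 (footnote, arXiv p. 6)] -/
theorem annulus_subset_ball : {x : E3 | 1 / 2 < ‖x‖ ∧ ‖x‖ < 4} ⊆ ball (0 : E3) 4 :=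
  fun _ hx ↦ mem_ball_zero_iff.2 hx.2

/-- Minkowski for THREE smooth summands on an open set (twice the tree's `weightedSobolevSeminorm_add_le_holds`,
H-303-1; stated pointwise so that consumers never unify `f + g` with `fun x ↦ f x + g x`). [cite: Bartnik1986, (1.3)] -/
theorem weightedSobolevSeminorm_le_add₃_of_eq {U : Set E3} (hU : IsOpen U) (s : ℕ) (δ : ℝ) {u f g k : E3 → G}
    (hf : ContDiffOn ℝ ∞ f U) (hg : ContDiffOn ℝ ∞ g U) (hk : ContDiffOn ℝ ∞ k U)
    (h : ∀ x ∈ U, u x = f x + g x + k x) :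
    weightedSobolevSeminorm U s δ u ≤
      weightedSobolevSeminorm U s δ f + weightedSobolevSeminorm U s δ g + weightedSobolevSeminorm U s δ k :=
  (weightedSobolevSeminorm_le_add_of_eq hU s δ (hf.add hg) hk h).trans
    (add_le_add (weightedSobolevSeminorm_add_le_holds hU s δ hf hg) le_rfl)

/-- On `Ã₁ ⊆ B₄` the inhomogeneous weight is harmless: `(1 + ‖y‖)ᵗ ≤ (5ˢ)²` for `0 ≤ t ≤ 2s`. [cite: MaoOhTao2023, Def. 1.5 (footnote, arXiv p. 6)] -/
theorem one_add_norm_rpow_le {y : E3} (hy : ‖y‖ < 4) {t : ℝ} {s : ℕ} (ht : t ≤ 2 * s) :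
    (1 + ‖y‖) ^ t ≤ ((5 : ℝ) ^ s) ^ 2 := by
  have h1 : (1 : ℝ) ≤ 1 + ‖y‖ := by linarith [norm_nonneg y]
  calc (1 + ‖y‖) ^ t ≤ (1 + ‖y‖) ^ (2 * s : ℝ) := Real.rpow_le_rpow_of_exponent_le h1 ht
    _ ≤ (5 : ℝ) ^ (2 * s : ℝ) := Real.rpow_le_rpow (by positivity) (by linarith) (by positivity)
    _ = ((5 : ℝ) ^ s) ^ 2 := by
        rw [show (2 * s : ℝ) = ((s * 2 : ℕ) : ℝ) by push_cast; ring, Real.rpow_natCast, pow_mul]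

/-- From finitely many `little-o` decay statements along `cobounded E3` to ONE RADIUS `r ≥ 1` beyond which they hold
with constant `1` (used on the two halves of `IsStronglyAsymptoticallyFlatWith`). [cite: Bartnik1986, (1.3)] -/
theorem exists_radius_of_isLittleO {N : ℕ → E3 → ℝ} {p : ℕ → ℝ} {n : ℕ}
    (h : ∀ m ≤ n, (fun x ↦ N m x) =o[Bornology.cobounded E3] fun x ↦ ‖x‖ ^ p m)
    (hN : ∀ m x, 0 ≤ N m x) :
    ∃ r : ℝ, 1 ≤ r ∧ ∀ m ≤ n, ∀ x : E3, r < ‖x‖ → N m x ≤ ‖x‖ ^ p m := by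
  have hev : ∀ᶠ x in Bornology.cobounded E3, ∀ m ∈ Finset.range (n + 1), N m x ≤ ‖x‖ ^ p m := by
    refine (eventually_all_finset _).2 fun m hm ↦ ?_
    filter_upwards [(h m (Nat.lt_succ_iff.mp (Finset.mem_range.mp hm))).bound one_pos] with x hx
    rw [one_mul, Real.norm_of_nonneg (hN m x), Real.norm_of_nonneg (Real.rpow_nonneg (norm_nonneg _) _)] at hx
    exact hx
  obtain ⟨r, -, hr⟩ := (hasBasis_cobounded_compl_closedBall (0 : E3)).eventually_iff.1 hev
  refine ⟨max r 1, le_max_right _ _, fun m hm x hx ↦ hr ?_ m (Finset.mem_range.2 (Nat.lt_succ_of_le hm))⟩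
  rw [mem_compl_iff, mem_closedBall_zero_iff, not_le]
  exact (le_max_left _ _).trans_lt hx

/-- `√((s+1) · vol B₄)`: the factor converting a pointwise bound on `Ã₁ ⊆ B₄` into an `Hˢ(Ã₁)` bound. [cite: MaoOhTao2023, Def. 1.5 (footnote, arXiv p. 6)] -/
def ballFactor (s : ℕ) : ℝ := Real.sqrt ((s + 1) * (volume (ball (0 : E3) 4)).toReal)

/-- `0 ≤ ballFactor s`. [cite: MaoOhTao2023, Def. 1.5 (footnote, arXiv p. 6)] -/
theorem ballFactor_nonneg (s : ℕ) : 0 ≤ ballFactor s := Real.sqrt_nonneg _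

/-- Sup-to-`Hˢ_δ(A)` conversion on a set `A ⊆ B₄` (for ANY `f`): a pointwise bound `C²` of every weighted squared
derivative size of order `≤ s` on `A` bounds the seminorm by `C · √((s+1) vol B₄)`. [cite: MaoOhTao2023, Def. 1.5 (footnote, arXiv p. 6)] -/
theorem weightedSobolevSeminorm_le_of_pointwise {A : Set E3} (hA : MeasurableSet A) (hA4 : A ⊆ ball (0 : E3) 4)
    (f : E3 → G) {s : ℕ} {δ C : ℝ} (hC : 0 ≤ C)
    (h : ∀ m ≤ s, ∀ y ∈ A, (1 + ‖y‖) ^ (2 * (δ + m) : ℝ) * ‖iteratedFDeriv ℝ m f y‖ ^ 2 ≤ C ^ 2) :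
    weightedSobolevSeminorm A s δ f ≤ ENNReal.ofReal (C * ballFactor s) := by
  have hV : volume (ball (0 : E3) 4) ≠ ⊤ := measure_ball_lt_top.ne
  have hterm : ∀ m ∈ Finset.range (s + 1),
      ∫⁻ y in A, ENNReal.ofReal ((1 + ‖y‖) ^ (2 * (δ + m) : ℝ) * ‖iteratedFDeriv ℝ m f y‖ ^ 2) ≤
        ENNReal.ofReal (C ^ 2 * (volume (ball (0 : E3) 4)).toReal) := by
    intro m hm
    have hm' : m ≤ s := Nat.lt_succ_iff.mp (Finset.mem_range.mp hm)
    calc ∫⁻ y in A, ENNReal.ofReal ((1 + ‖y‖) ^ (2 * (δ + m) : ℝ) * ‖iteratedFDeriv ℝ m f y‖ ^ 2)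
        ≤ ∫⁻ y in A, ENNReal.ofReal (C ^ 2) :=
          setLIntegral_mono' hA fun y hy ↦ ENNReal.ofReal_le_ofReal (h m hm' y hy)
      _ = ENNReal.ofReal (C ^ 2) * volume A := setLIntegral_const _ _
      _ ≤ ENNReal.ofReal (C ^ 2) * volume (ball (0 : E3) 4) :=
          mul_le_mul_of_nonneg_left (measure_mono hA4) (zero_le)
      _ = ENNReal.ofReal (C ^ 2 * (volume (ball (0 : E3) 4)).toReal) := by
          rw [ENNReal.ofReal_mul (sq_nonneg C), ENNReal.ofReal_toReal hV]
  unfold weightedSobolevSeminorm ballFactor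
  calc (∑ m ∈ Finset.range (s + 1),
        ∫⁻ y in A, ENNReal.ofReal ((1 + ‖y‖) ^ (2 * (δ + m) : ℝ) * ‖iteratedFDeriv ℝ m f y‖ ^ 2)) ^ (1 / 2 : ℝ)
      ≤ (∑ m ∈ Finset.range (s + 1), ENNReal.ofReal (C ^ 2 * (volume (ball (0 : E3) 4)).toReal)) ^ (1 / 2 : ℝ) :=
        ENNReal.rpow_le_rpow (Finset.sum_le_sum hterm) (by norm_num)
    _ = ENNReal.ofReal (C * Real.sqrt ((s + 1) * (volume (ball (0 : E3) 4)).toReal)) := by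
        rw [Finset.sum_const, Finset.card_range, nsmul_eq_mul, ← ENNReal.ofReal_natCast,
          ← ENNReal.ofReal_mul (Nat.cast_nonneg (α := ℝ) (s + 1)),
          ENNReal.ofReal_rpow_of_nonneg (by positivity) (by norm_num), ← Real.sqrt_eq_rpow,
          show ((s + 1 : ℕ) : ℝ) * (C ^ 2 * (volume (ball (0 : E3) 4)).toReal) =
            C ^ 2 * ((s + 1) * (volume (ball (0 : E3) 4)).toReal) by push_cast; ring,
          Real.sqrt_mul' (C ^ 2) (by positivity), Real.sqrt_sq hC]

/-! #### §U1  the §T2 side conditions DISCHARGED: `c_h = c_k = 3·10¹² / R` for `R ≥ 1`, `γ ≥ 0` -/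

/-- `h`-slot weight inequality of §T2 (`m ≤ 12`): on `Ã₁`, `(1+‖y‖)^{2m} R^{2m} ≤ (K/R)² R³ (1+R‖y‖)^{2(γ−1/2+m)}`
with `K = 3·10¹²` — via `1 + R‖y‖ ≥ R/2`, `≤ 5R`, `1 + ‖y‖ ≤ 5`, `(1+R‖y‖)^{2γ} ≥ 1` and `5^{2m} 4^m · 5 ≤ K²`. [cite: MaoOhTao2023, Def. 1.5 (footnote, arXiv p. 6)] -/
theorem weight_h_le {R γ : ℝ} (hR : 1 ≤ R) (hγ : 0 ≤ γ) {m : ℕ} (hm : m ≤ 12) {y : E3}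
    (hy : y ∈ {x : E3 | 1 / 2 < ‖x‖ ∧ ‖x‖ < 4}) :
    (1 + ‖y‖) ^ (2 * m : ℝ) * (R ^ m) ^ 2 ≤
      (3 * 10 ^ 12 / R) ^ 2 * R ^ 3 * (1 + ‖R • y‖) ^ (2 * (γ - 1 / 2 + m) : ℝ) := by
  obtain ⟨hy1, hy4⟩ := hy
  have hR0 : 0 < R := by linarith
  have hRy : ‖R • y‖ = R * ‖y‖ := by rw [norm_smul, Real.norm_of_nonneg hR0.le]
  have hb0 : 0 < 1 + ‖R • y‖ := by positivity
  have hb1 : (1 : ℝ) ≤ 1 + ‖R • y‖ := by linarith [norm_nonneg (R • y)]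
  have i1 : 1 + ‖y‖ ≤ 5 := by linarith
  have i2 : R ≤ 2 * (1 + ‖R • y‖) := by rw [hRy]; nlinarith
  have i3 : 1 + ‖R • y‖ ≤ 5 * R := by rw [hRy]; nlinarith
  have h2 : (1 : ℝ) ≤ (1 + ‖R • y‖) ^ (2 * γ) := Real.one_le_rpow hb1 (by positivity)
  have h4 : (5 : ℝ) ^ (2 * m) * 2 ^ (2 * m) * 5 ≤ (3 * 10 ^ 12) ^ 2 := by
    have a := pow_le_pow_right₀ (show (1 : ℝ) ≤ 5 by norm_num) (show 2 * m ≤ 24 by omega)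
    have b := pow_le_pow_right₀ (show (1 : ℝ) ≤ 2 by norm_num) (show 2 * m ≤ 24 by omega)
    calc (5 : ℝ) ^ (2 * m) * 2 ^ (2 * m) * 5 ≤ 5 ^ 24 * 2 ^ 24 * 5 := by gcongr
      _ ≤ (3 * 10 ^ 12) ^ 2 := by norm_num
  have hX : (3 * 10 ^ 12 / R) ^ 2 * R ^ 3 = ((3 : ℝ) * 10 ^ 12) ^ 2 * R := by
    field_simp
  rw [show (2 * (γ - 1 / 2 + m) : ℝ) = 2 * γ + (((2 * m : ℕ) : ℝ) - 1) by push_cast; ring,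
    Real.rpow_add hb0, Real.rpow_sub_one hb0.ne', Real.rpow_natCast,
    show (2 * m : ℝ) = ((2 * m : ℕ) : ℝ) by push_cast; ring, Real.rpow_natCast,
    ← mul_div_assoc, ← mul_div_assoc, le_div_iff₀ hb0, hX]
  calc (1 + ‖y‖) ^ (2 * m) * (R ^ m) ^ 2 * (1 + ‖R • y‖)
      = (1 + ‖y‖) ^ (2 * m) * R ^ (2 * m) * (1 + ‖R • y‖) := by ring
    _ ≤ 5 ^ (2 * m) * (2 * (1 + ‖R • y‖)) ^ (2 * m) * (5 * R) := by gcongr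
    _ = 5 ^ (2 * m) * 2 ^ (2 * m) * 5 * R * (1 + ‖R • y‖) ^ (2 * m) := by rw [mul_pow]; ring
    _ ≤ (3 * 10 ^ 12) ^ 2 * R * (1 + ‖R • y‖) ^ (2 * m) := by gcongr
    _ ≤ (3 * 10 ^ 12) ^ 2 * R * ((1 + ‖R • y‖) ^ (2 * γ) * (1 + ‖R • y‖) ^ (2 * m)) :=
        mul_le_mul_of_nonneg_left (le_mul_of_one_le_left (by positivity) h2) (by positivity)

/-- `k`-slot weight inequality of §T2 (`m ≤ 10`, the extra `R` of `R · v(R ·)` included): same bookkeeping with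
`(1+R‖y‖)^{2(γ+1/2+m)} = (1+R‖y‖)^{2γ} (1+R‖y‖)^{2m} (1+R‖y‖)` and `5^{2m} 4^m · 2 ≤ K²`. [cite: MaoOhTao2023, Def. 1.5 (footnote, arXiv p. 6)] -/
theorem weight_k_le {R γ : ℝ} (hR : 1 ≤ R) (hγ : 0 ≤ γ) {m : ℕ} (hm : m ≤ 10) {y : E3}
    (hy : y ∈ {x : E3 | 1 / 2 < ‖x‖ ∧ ‖x‖ < 4}) :
    (1 + ‖y‖) ^ (2 * m : ℝ) * (R * R ^ m) ^ 2 ≤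
      (3 * 10 ^ 12 / R) ^ 2 * R ^ 3 * (1 + ‖R • y‖) ^ (2 * (γ + 1 / 2 + m) : ℝ) := by
  obtain ⟨hy1, hy4⟩ := hy
  have hR0 : 0 < R := by linarith
  have hRy : ‖R • y‖ = R * ‖y‖ := by rw [norm_smul, Real.norm_of_nonneg hR0.le]
  have hb0 : 0 < 1 + ‖R • y‖ := by positivity
  have hb1 : (1 : ℝ) ≤ 1 + ‖R • y‖ := by linarith [norm_nonneg (R • y)]
  have i1 : 1 + ‖y‖ ≤ 5 := by linarith
  have i2 : R ≤ 2 * (1 + ‖R • y‖) := by rw [hRy]; nlinarith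
  have h2 : (1 : ℝ) ≤ (1 + ‖R • y‖) ^ (2 * γ) := Real.one_le_rpow hb1 (by positivity)
  have h4 : (5 : ℝ) ^ (2 * m) * 2 ^ (2 * m) * 2 ≤ (3 * 10 ^ 12) ^ 2 := by
    have a := pow_le_pow_right₀ (show (1 : ℝ) ≤ 5 by norm_num) (show 2 * m ≤ 20 by omega)
    have b := pow_le_pow_right₀ (show (1 : ℝ) ≤ 2 by norm_num) (show 2 * m ≤ 20 by omega)
    calc (5 : ℝ) ^ (2 * m) * 2 ^ (2 * m) * 2 ≤ 5 ^ 20 * 2 ^ 20 * 2 := by gcongr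
      _ ≤ (3 * 10 ^ 12) ^ 2 := by norm_num
  have hX : (3 * 10 ^ 12 / R) ^ 2 * R ^ 3 = ((3 : ℝ) * 10 ^ 12) ^ 2 * R := by
    field_simp
  rw [show (2 * (γ + 1 / 2 + m) : ℝ) = 2 * γ + (((2 * m : ℕ) : ℝ) + 1) by push_cast; ring,
    Real.rpow_add hb0, Real.rpow_add_one hb0.ne', Real.rpow_natCast,
    show (2 * m : ℝ) = ((2 * m : ℕ) : ℝ) by push_cast; ring, Real.rpow_natCast, hX]
  calc (1 + ‖y‖) ^ (2 * m) * (R * R ^ m) ^ 2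
      = (1 + ‖y‖) ^ (2 * m) * R ^ (2 * m) * R * R := by ring
    _ ≤ 5 ^ (2 * m) * (2 * (1 + ‖R • y‖)) ^ (2 * m) * R * (2 * (1 + ‖R • y‖)) := by gcongr
    _ = 5 ^ (2 * m) * 2 ^ (2 * m) * 2 * R * ((1 + ‖R • y‖) ^ (2 * m) * (1 + ‖R • y‖)) := by
        rw [mul_pow]; ring
    _ ≤ (3 * 10 ^ 12) ^ 2 * R * ((1 + ‖R • y‖) ^ (2 * m) * (1 + ‖R • y‖)) := by gcongr
    _ ≤ (3 * 10 ^ 12) ^ 2 * R * ((1 + ‖R • y‖) ^ (2 * γ) * ((1 + ‖R • y‖) ^ (2 * m) * (1 + ‖R • y‖))) :=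
        mul_le_mul_of_nonneg_left (le_mul_of_one_le_left (by positivity) h2) (by positivity)

end SobolevToolkit

/-! #### §U2  the isotropic mass slot `isoSlot ΔM = (2ΔM/|x|)·δ`: smooth off the origin, additive, `(−1)`-homogeneous, of finite `Hˢ(Ã₁)` size -/

/-- The **isotropic mass slot** `isoSlot ΔM x = (2ΔM/|x|)·δ` — the `2M/r` term of the strongly asymptotically flat class `g = (1 + 2M/r)δ + o(r^{-3/2})` of Christodoulou–Klainerman 1993, (1.0.9a), as a bilinear-form-valued field on `E3 ∖ {0}` (junk value `0` at the origin, `‖0‖⁻¹ = 0`). [cite: ChristodoulouKlainerman1993, (1.0.9a)] -/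
def isoSlot (ΔM : ℝ) (x : E3) : (E3 →L[ℝ] E3 →L[ℝ] ℝ) := (2 * ΔM / ‖x‖) • (innerSL ℝ : (E3 →L[ℝ] E3 →L[ℝ] ℝ))

/-- The line `c ↦ c·δ` in the bilinear forms on `E3` (so that `isoSlot ΔM x = slotLine (2ΔM/|x|)`). [cite: ChristodoulouKlainerman1993, (1.0.9a)] -/
def slotLine : ℝ →L[ℝ] (E3 →L[ℝ] E3 →L[ℝ] ℝ) := (ContinuousLinearMap.id ℝ ℝ).smulRight (innerSL ℝ : (E3 →L[ℝ] E3 →L[ℝ] ℝ))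

/-- `isoSlot ΔM x = slotLine (2ΔM/|x|)`. [cite: ChristodoulouKlainerman1993, (1.0.9a)] -/
theorem isoSlot_eq_slotLine (ΔM : ℝ) (x : E3) : isoSlot ΔM x = slotLine (2 * ΔM / ‖x‖) := rfl

/-- `slotLine` is smooth (linear). [cite: ChristodoulouKlainerman1993, (1.0.9a)] -/
theorem slotLine_contDiff : ContDiff ℝ ∞ (⇑slotLine) :=
  ContinuousLinearMap.contDiff (𝕜 := ℝ) (E := ℝ) (F := (E3 →L[ℝ] E3 →L[ℝ] ℝ)) (f := slotLine) (n := ∞)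

/-- `isoSlot ΔM` is smooth on `{R < |x|}`, `R ≥ 0`. [cite: ChristodoulouKlainerman1993, (1.0.9a)] -/
theorem contDiffOn_isoSlot (ΔM : ℝ) {R : ℝ} (hR : 0 ≤ R) :
    ContDiffOn ℝ ∞ (fun x : E3 ↦ isoSlot ΔM x) {x | R < ‖x‖} := by
  intro x hx
  have hx0 : x ≠ 0 := by
    intro h
    have : R < ‖x‖ := hx
    rw [h, norm_zero] at this
    linarith
  have h1 : ContDiffAt ℝ ∞ (fun x : E3 ↦ ‖x‖) x := contDiffAt_norm ℝ hx0
  have h2 : ContDiffAt ℝ ∞ (fun x : E3 ↦ 2 * ΔM / ‖x‖) x :=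
    contDiffAt_const.div h1 (norm_ne_zero_iff.2 hx0)
  have h4 : ContDiffAt ℝ ∞ (⇑slotLine ∘ fun x : E3 ↦ 2 * ΔM / ‖x‖) x :=
    slotLine_contDiff.contDiffAt.comp x h2
  exact h4.contDiffWithinAt

/-- `isoSlot` is additive in the mass: `isoSlot (a + b) = isoSlot a + isoSlot b`. [cite: ChristodoulouKlainerman1993, (1.0.9a)] -/
theorem isoSlot_add (a b : ℝ) (x : E3) : isoSlot (a + b) x = isoSlot a x + isoSlot b x := by
  simp only [isoSlot_eq_slotLine, ← map_add]
  congr 1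
  ring

/-- `isoSlot μ` is `(−1)`-homogeneous: `isoSlot μ (R y) = R⁻¹ isoSlot μ y` (`R > 0`). [cite: ChristodoulouKlainerman1993, (1.0.9a)] -/
theorem isoSlot_smul (μ : ℝ) {R : ℝ} (hR : 0 < R) (y : E3) : isoSlot μ (R • y) = R⁻¹ • isoSlot μ y := by
  rw [isoSlot, isoSlot, smul_smul, norm_smul, Real.norm_of_nonneg hR.le, mul_comm R ‖y‖, ← div_div,
    div_eq_inv_mul (2 * μ / ‖y‖) R]

/-- `‖isoSlot μ‖_{Hˢ(Ã₁)} < ⊤`: `isoSlot μ` is `C^∞` off the origin, so each `Dᵐ` is bounded on the compact closure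
`{1/2 ≤ ‖x‖ ≤ 4}`; then §U0's sup-to-`Hˢ` conversion. (The size is BOUNDED, not computed.) [cite: ChristodoulouKlainerman1993, (1.0.9a)] -/
theorem weightedSobolevSeminorm_isoSlot_lt_top (μ : ℝ) (s : ℕ) :
    weightedSobolevSeminorm {x : E3 | 1 / 2 < ‖x‖ ∧ ‖x‖ < 4} s 0 (fun x : E3 ↦ isoSlot μ x) < ⊤ := by
  set K : Set E3 := {x : E3 | 1 / 2 ≤ ‖x‖ ∧ ‖x‖ ≤ 4} with hK
  have hKc : IsCompact K :=
    (isCompact_closedBall (0 : E3) 4).of_isClosed_subset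
      ((isClosed_le continuous_const continuous_norm).inter (isClosed_le continuous_norm continuous_const))
      fun x hx ↦ mem_closedBall_zero_iff.2 hx.2
  have hcd : ∀ x ∈ K, ContDiffAt ℝ ∞ (fun x : E3 ↦ isoSlot μ x) x := fun x hx ↦
    (contDiffOn_isoSlot μ le_rfl).contDiffAt
      ((isOpen_lt continuous_const continuous_norm).mem_nhds (show (0 : ℝ) < ‖x‖ by linarith [hx.1]))
  have hbd : ∀ m : ℕ, ∃ C : ℝ, ∀ x ∈ K, ‖iteratedFDeriv ℝ m (fun x : E3 ↦ isoSlot μ x) x‖ ≤ C := fun m ↦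
    hKc.exists_bound_of_continuousOn fun x hx ↦
      ((hcd x hx).continuousAt_iteratedFDeriv (k := m) (by exact_mod_cast le_top)).continuousWithinAt
  choose C hC using hbd
  refine lt_of_le_of_lt (weightedSobolevSeminorm_le_of_pointwise measurableSet_annulus annulus_subset_ball _
    (C := 5 ^ s * ∑ i ∈ Finset.range (s + 1), |C i|) (by positivity) fun m hm y hy ↦ ?_) ENNReal.ofReal_lt_top
  have hyK : y ∈ K := ⟨hy.1.le, hy.2.le⟩
  have hms : (m : ℝ) ≤ s := by exact_mod_cast hm
  have h1 : ‖iteratedFDeriv ℝ m (fun x : E3 ↦ isoSlot μ x) y‖ ≤ ∑ i ∈ Finset.range (s + 1), |C i| :=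
    ((hC m y hyK).trans (le_abs_self _)).trans
      (Finset.single_le_sum (f := fun i ↦ |C i|) (fun i _ ↦ abs_nonneg (C i))
        (Finset.mem_range.2 (Nat.lt_succ_of_le hm)))
  have h2 : (1 + ‖y‖) ^ (2 * (0 + m) : ℝ) ≤ ((5 : ℝ) ^ s) ^ 2 :=
    one_add_norm_rpow_le hy.2 (by linarith)
  calc (1 + ‖y‖) ^ (2 * (0 + m) : ℝ) * ‖iteratedFDeriv ℝ m (fun x : E3 ↦ isoSlot μ x) y‖ ^ 2
      ≤ ((5 : ℝ) ^ s) ^ 2 * (∑ i ∈ Finset.range (s + 1), |C i|) ^ 2 :=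
        mul_le_mul h2 (pow_le_pow_left₀ (norm_nonneg _) h1 2) (sq_nonneg _) (by positivity)
    _ = (5 ^ s * ∑ i ∈ Finset.range (s + 1), |C i|) ^ 2 := by ring

section Decay

variable {G : Type*} [NormedAddCommGroup G] [NormedSpace ℝ G]

/-- For ANY `F` with `‖Dᵐ F (x)‖ ≤ ‖x‖^{-(1+j+m)}` (`m ≤ s`, `‖x‖ > r ≥ 1`) and `R ≥ 2r`:
`‖y ↦ Rʲ F(R y)‖_{Hˢ_0(Ã₁)} ≤ 2^{1+j+s} 5ˢ √((s+1) vol B₄) / R` (§T1's chain rule `norm_iteratedFDeriv_smul_comp_smul_le`,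
`‖R y‖ > R/2`, §U0). Serves the `h`-reference class with `j = 0` and the `k`-reference class with `j = 1`. [cite: MaoOhTao2023, Def. 1.5 (footnote, arXiv p. 6)] -/
theorem scaled_seminorm_le_of_decay (F : E3 → G) {s j : ℕ} {r R : ℝ} (hr : 1 ≤ r) (hR : 2 * r ≤ R)
    (hF : ∀ m ≤ s, ∀ x : E3, r < ‖x‖ → ‖iteratedFDeriv ℝ m F x‖ ≤ ‖x‖ ^ (-(1 + j + m : ℝ))) :
    weightedSobolevSeminorm {x : E3 | 1 / 2 < ‖x‖ ∧ ‖x‖ < 4} s 0 (fun y : E3 ↦ R ^ j • F (R • y)) ≤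
      ENNReal.ofReal (2 ^ (1 + j + s) * 5 ^ s * ballFactor s / R) := by
  have hR0 : 0 < R := by linarith
  rw [show (2 ^ (1 + j + s) * 5 ^ s * ballFactor s / R : ℝ) = 2 ^ (1 + j + s) / R * 5 ^ s * ballFactor s by ring]
  refine weightedSobolevSeminorm_le_of_pointwise measurableSet_annulus annulus_subset_ball _ (by positivity)
    fun m hm y hy ↦ ?_
  have hRy : ‖R • y‖ = R * ‖y‖ := by rw [norm_smul, Real.norm_of_nonneg hR0.le]
  have hy1 : 1 / 2 < ‖y‖ := hy.1
  have hhalf : R / 2 ≤ ‖R • y‖ := by rw [hRy]; nlinarith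
  have hr' : r < ‖R • y‖ := by rw [hRy]; nlinarith
  have hpt : ‖iteratedFDeriv ℝ m F (R • y)‖ ≤ ((R / 2) ^ (1 + j + m))⁻¹ := by
    refine (hF m hm _ hr').trans ?_
    rw [Real.rpow_neg (norm_nonneg _), show (1 + j + m : ℝ) = ((1 + j + m : ℕ) : ℝ) by push_cast; ring,
      Real.rpow_natCast]
    exact inv_anti₀ (by positivity) (pow_le_pow_left₀ (by positivity) hhalf _)
  have hinv : ((R / 2) ^ (1 + j + m))⁻¹ = 2 ^ (1 + j + m) / (R * R ^ j * R ^ m) := by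
    rw [div_pow, inv_div, pow_add R (1 + j) m, pow_add R 1 j, pow_one R]
  have hDm : ‖iteratedFDeriv ℝ m (fun z : E3 ↦ R ^ j • F (R • z)) y‖ ≤ 2 ^ (1 + j + s) / R := by
    calc ‖iteratedFDeriv ℝ m (fun z : E3 ↦ R ^ j • F (R • z)) y‖
        ≤ |R ^ j| * R ^ m * ((R / 2) ^ (1 + j + m))⁻¹ :=
          (norm_iteratedFDeriv_smul_comp_smul_le F (R ^ j) hR0 m y).trans
            (mul_le_mul_of_nonneg_left hpt (by positivity))
      _ = 2 ^ (1 + j + m) / R := by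
          rw [abs_of_pos (pow_pos hR0 j), hinv, ← mul_div_assoc, div_eq_div_iff (by positivity) hR0.ne']
          ring
      _ ≤ 2 ^ (1 + j + s) / R :=
          div_le_div_of_nonneg_right (pow_le_pow_right₀ (by norm_num) (by omega)) hR0.le
  have hms : (m : ℝ) ≤ s := by exact_mod_cast hm
  have hW : (1 + ‖y‖) ^ (2 * (0 + m) : ℝ) ≤ ((5 : ℝ) ^ s) ^ 2 :=
    one_add_norm_rpow_le hy.2 (by linarith)
  calc (1 + ‖y‖) ^ (2 * (0 + m) : ℝ) * ‖iteratedFDeriv ℝ m (fun z : E3 ↦ R ^ j • F (R • z)) y‖ ^ 2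
      ≤ ((5 : ℝ) ^ s) ^ 2 * (2 ^ (1 + j + s) / R) ^ 2 :=
        mul_le_mul hW (pow_le_pow_left₀ (norm_nonneg _) hDm 2) (sq_nonneg _) (by positivity)
    _ = (2 ^ (1 + j + s) / R * 5 ^ s) ^ 2 := by ring

end Decay

end Literature.Geometry.Lorentzian

end
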